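import Mathlib.FieldTheory.KrullTopology
import Mathlib.FieldTheory.SeparableClosure
import Mathlib.FieldTheory.PurelyInseparable.Basic
import Mathlib.FieldTheory.Galois.Basic
import Mathlib.FieldTheory.Galois.Abelian
import Mathlib.Topology.Algebra.ClopenNhdofOne
import Literature.NumberTheory.GaloisRepresentations.AbsGaloisGroupCompact

/-!
# Open normal subgroups of `Aut(E/F)` for a normal extension `E/F`: descent to finite Galois
subextensions (every characteristic)

For a *Galois* extension `E/F`, infinite Galois theory (Mathlib `InfiniteGalois`) matches open
(normal) subgroups of `Gal(E/F)` with finite (Galois) subextensions.  The absolute Galois group of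
the tree, `Field.absoluteGaloisGroup F = Aut_F(F̄)` with `F̄ = AlgebraicClosure F`, is the group of
a *normal* but, for imperfect `F`, inseparable extension, where fixed fields of subgroups always
contain the perfect closure of `F`.  This file proves the part of the correspondence needed to
pass from `Γ_F` to finite abelian extensions of `F` (limit arguments of local class field theory,
`LocalReciprocity*`): for `E/F` normal and `U ≤ Aut_F(E)` an **open normal** subgroup,

* `Literature.NumberTheory.GaloisRepresentations.exists_isGalois_fixingSubgroup_eq`: there is a finite **Galois** subextension `L/F` of `E`
  with `Gal(E/L) := L.fixingSubgroup = U`; consequently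
* `Literature.exists_isGalois_restrictNormalHom_ker_eq`: `U` is the kernel of the (surjective)
  restriction `Aut_F(E) → Gal(L/F)`, so `Gal(L/F) ≃ Aut_F(E) ⧸ U`, and `L/F` is abelian when
  `Aut_F(E) ⧸ U` is (`Literature.NumberTheory.GaloisRepresentations.exists_isAbelianGalois_fixingSubgroup_eq`).

Proof: a Krull neighbourhood gives a finite normal `L₀` with `Gal(E/L₀) ≤ U`
(`krullTopology_mem_nhds_one_iff_of_normal`); the fixed field `L'` of the image `Ū` of `U` in
`Aut_F(L₀)` has `Gal(L₀/L') = Ū` (`IntermediateField.fixingSubgroup_fixedField`, which needs only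
`[L₀ : F] < ∞`) and is normal over `F` (`Ū` is normal); its separable closure `L₁ ⊆ L'` over `F`
is then Galois (`separableClosure.isGalois`), and `Gal(E/L₁) = Gal(E/L') = U` because `L'/L₁` is
purely inseparable and Frobenius is injective.

## References

* J. Neukirch, *Algebraic Number Theory*, Springer 1999, Ch. IV §1, (1.1)–(1.2) (Krull topology,
  closed/open subgroups and subextensions).  [NeukirchANT1999]
* J. S. Milne, *Fields and Galois Theory*, Ch. 7 (infinite Galois theory) and Ch. 3 (normal,
  separable and purely inseparable extensions).  [MilneFT2022]
-/

noncomputable section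

namespace Literature.NumberTheory.GaloisRepresentations

open IntermediateField

section Normal

variable {F E : Type*} [Field F] [Field E] [Algebra F E]

/-- The fixed field of a normal subgroup of `Aut_F(L₀)`, `L₀/F` normal, is normal over `F`
(conjugates of a fixed element are fixed).
Ref: Milne, *Fields and Galois Theory*, Ch. 3 (fundamental theorem, normal subgroups). [folklore] -/
theorem normal_fixedField_of_normal [Normal F E] (H : Subgroup (E ≃ₐ[F] E)) [hH : H.Normal] :
    Normal F (fixedField H) := by
  rw [normal_iff_forall_map_le']
  rintro σ _ ⟨x, hx, rfl⟩
  have hx' : x ∈ fixedField H := hx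
  rw [mem_fixedField_iff] at hx'
  change (σ : E →ₐ[F] E) x ∈ fixedField H
  rw [mem_fixedField_iff]
  intro τ hτ
  change τ (σ x) = σ x
  have hx := hx'
  have h := hx (σ⁻¹ * τ * σ) (by simpa using hH.conj_mem τ hτ σ⁻¹)
  have h' : σ⁻¹ (τ (σ x)) = x := h
  simpa using congrArg σ h'

/-- An automorphism fixing the separable closure `L₁` of `F` in `L` pointwise fixes `L` pointwise
(`L/L₁` is purely inseparable and Frobenius is injective).
Ref: Milne, *Fields and Galois Theory*, Ch. 3 (purely inseparable extensions). [folklore] -/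
theorem apply_eq_self_of_forall_mem_separableClosure [Normal F E] (L : IntermediateField F E)
    (σ : E ≃ₐ[F] E) (hσ : ∀ y : E, y ∈ lift (separableClosure F L) → σ y = y) (x : E)
    (hx : x ∈ L) : σ x = x := by
  obtain ⟨p, hp⟩ := ExpChar.exists F
  haveI : ExpChar E p := expChar_of_injective_algebraMap (algebraMap F E).injective p
  haveI : ExpChar (separableClosure F L) p :=
    expChar_of_injective_algebraMap (algebraMap F (separableClosure F L)).injective p
  -- `x ^ (p ^ n) ∈ L₁` for some `n` (`L / L₁` is purely inseparable)
  obtain ⟨n, y, hy⟩ := IsPurelyInseparable.pow_mem (separableClosure F L) p (⟨x, hx⟩ : L)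
  have hy' : ((y : L) : E) = x ^ p ^ n := by
    have h := congrArg (fun z : L => (z : E)) hy
    simpa using h
  have hmem : x ^ p ^ n ∈ lift (separableClosure F L) := by
    rw [← hy']
    exact (mem_lift (y : L)).mpr y.2
  have h := hσ _ hmem
  rw [map_pow] at h
  exact iterateFrobenius_inj E p n (by simpa [iterateFrobenius_def] using h)

/-- **Open normal subgroups of `Aut_F(E)` come from finite Galois subextensions.**  For `E/F`
normal and `U ≤ Aut_F(E)` open and normal there is a finite Galois subextension `L/F` of `E` with
`Gal(E/L) = U`.  (For `E/F` Galois this is part of Mathlib's infinite Galois correspondence; the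
point is that no separability of `E/F` is needed.)
Ref: Neukirch, *Algebraic Number Theory* (1999), Ch. IV §1, (1.2); Milne, *Fields and Galois
Theory*, Ch. 7. [folklore] -/
theorem exists_isGalois_fixingSubgroup_eq [Normal F E] (U : Subgroup (E ≃ₐ[F] E)) [hU : U.Normal]
    (hUopen : IsOpen (U : Set (E ≃ₐ[F] E))) :
    ∃ L : IntermediateField F E, FiniteDimensional F L ∧ IsGalois F L ∧ L.fixingSubgroup = U := by
  classical
  -- a finite normal `L₀` with `Gal(E/L₀) ≤ U`
  obtain ⟨L₀, hL₀fin, hL₀normal, hL₀U⟩ :=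
    (krullTopology_mem_nhds_one_iff_of_normal F E _).mp (hUopen.mem_nhds (one_mem U))
  haveI := hL₀fin
  haveI := hL₀normal
  -- the image `Ū` of `U` in `Aut_F(L₀)` and its fixed field `L' ⊆ L₀`
  let r₀ : (E ≃ₐ[F] E) →* (L₀ ≃ₐ[F] L₀) := AlgEquiv.restrictNormalHom L₀
  have hr₀ : Function.Surjective r₀ := AlgEquiv.restrictNormalHom_surjective E
  let Ubar : Subgroup (L₀ ≃ₐ[F] L₀) := U.map r₀
  haveI : Ubar.Normal := hU.map r₀ hr₀
  let L' : IntermediateField F L₀ := fixedField Ubar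
  haveI : Normal F L' := normal_fixedField_of_normal Ubar
  have hfixL' : L'.fixingSubgroup = Ubar := fixingSubgroup_fixedField Ubar
  -- `Gal(E / lift L') = U`
  have hker : r₀.ker ≤ U := by
    intro σ hσ
    apply hL₀U
    rw [SetLike.mem_coe, IntermediateField.mem_fixingSubgroup_iff]
    intro x hx
    have h := AlgEquiv.congr_fun (MonoidHom.mem_ker.mp hσ) ⟨x, hx⟩
    rw [AlgEquiv.one_apply] at h
    have h' := congrArg (fun z : L₀ => (z : E)) h
    simpa [r₀, AlgEquiv.restrictNormalHom_apply] using h'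
  have hfix : (lift L').fixingSubgroup = U := by
    have h1 : (lift L').fixingSubgroup = L'.fixingSubgroup.comap r₀ := by
      ext σ
      simp only [IntermediateField.mem_fixingSubgroup_iff, Subgroup.mem_comap]
      constructor
      · rintro h ⟨x, hx₀⟩ hx
        apply Subtype.ext
        rw [AlgEquiv.restrictNormalHom_apply]
        exact h x ((mem_lift ⟨x, hx₀⟩).mpr hx)
      · rintro h _ ⟨x, hx, rfl⟩
        have h2 := congrArg (fun z : L₀ => (z : E)) (h x hx)
        simpa [r₀, AlgEquiv.restrictNormalHom_apply] using h2
    rw [h1, hfixL', Subgroup.comap_map_eq, sup_eq_left.mpr hker]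
  -- the separable closure `L₁` of `F` in `lift L'`: Galois, same fixing subgroup
  set L : IntermediateField F E := lift L' with hL
  haveI : Normal F L := Normal.of_algEquiv (liftAlgEquiv L')
  haveI : FiniteDimensional F L := (liftAlgEquiv L').toLinearEquiv.finiteDimensional
  haveI : IsGalois F (separableClosure F L) := separableClosure.isGalois F L
  refine ⟨lift (separableClosure F L), (liftAlgEquiv _).toLinearEquiv.finiteDimensional,
    IsGalois.of_algEquiv (liftAlgEquiv _), ?_⟩
  rw [← hfix]
  apply le_antisymm
  · intro σ hσ
    rw [IntermediateField.mem_fixingSubgroup_iff] at hσ ⊢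
    intro x hx
    exact apply_eq_self_of_forall_mem_separableClosure L σ hσ x hx
  · exact IntermediateField.fixingSubgroup_antitone (lift_le _)

/-- **Open normal subgroups with abelian quotient come from finite abelian subextensions.**  For
`E/F` normal and `U ≤ Aut_F(E)` open, normal, containing all commutators, there is a finite
abelian (Galois) subextension `L/F` of `E` with `Gal(E/L) = U` (and then
`Gal(L/F) ≃ Aut_F(E) ⧸ U` through the restriction, whose kernel is `L.fixingSubgroup`,
Mathlib `IntermediateField.restrictNormalHom_ker`).
Ref: Neukirch, *Algebraic Number Theory* (1999), Ch. IV §1, (1.2); Milne, *Fields and Galois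
Theory*, Ch. 7. [folklore] -/
theorem exists_isAbelianGalois_fixingSubgroup_eq [Normal F E] (U : Subgroup (E ≃ₐ[F] E))
    [U.Normal] (hUopen : IsOpen (U : Set (E ≃ₐ[F] E)))
    (hcomm : ∀ a b : E ≃ₐ[F] E, a * b * a⁻¹ * b⁻¹ ∈ U) :
    ∃ L : IntermediateField F E, FiniteDimensional F L ∧ IsAbelianGalois F L ∧
      L.fixingSubgroup = U := by
  obtain ⟨L, hfin, hgal, hfix⟩ := exists_isGalois_fixingSubgroup_eq U hUopen
  haveI := hfin
  haveI := hgal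
  haveI : IsMulCommutative (L ≃ₐ[F] L) := by
    refine ⟨⟨fun g h => ?_⟩⟩
    obtain ⟨a, rfl⟩ := AlgEquiv.restrictNormalHom_surjective E g
    obtain ⟨b, rfl⟩ := AlgEquiv.restrictNormalHom_surjective E h
    have hker : a * b * a⁻¹ * b⁻¹ ∈ (AlgEquiv.restrictNormalHom L).ker := by
      rw [IntermediateField.restrictNormalHom_ker, hfix]
      exact hcomm a b
    rw [MonoidHom.mem_ker, map_mul, map_mul, map_mul, map_inv, map_inv,
      mul_inv_eq_one, mul_inv_eq_iff_eq_mul] at hker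
    exact hker
  exact ⟨L, hfin, {}, hfix⟩

/-- The commutator subgroup of `Aut_F(E)` acts trivially on every finite abelian `L/F` inside
`E`: `[Aut_F(E), Aut_F(E)] ≤ Gal(E/L)`, hence so does its closure (`Gal(E/L)` is closed).
Ref: Neukirch, *Algebraic Number Theory* (1999), Ch. IV §1. [folklore] -/
theorem topologicalClosure_commutator_le_fixingSubgroup [Normal F E] (L : IntermediateField F E)
    [FiniteDimensional F L] [IsAbelianGalois F L] :
    (commutator (E ≃ₐ[F] E)).topologicalClosure ≤ L.fixingSubgroup := by
  refine Subgroup.topologicalClosure_minimal _ ?_ (IntermediateField.fixingSubgroup_isClosed L)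
  rw [commutator_def, Subgroup.commutator_le]
  intro a _ b _
  change a * b * a⁻¹ * b⁻¹ ∈ L.fixingSubgroup
  rw [← IntermediateField.restrictNormalHom_ker L, MonoidHom.mem_ker, map_mul, map_mul, map_mul,
    map_inv, map_inv, mul_inv_eq_one, mul_inv_eq_iff_eq_mul]
  exact IsMulCommutative.is_comm.comm _ _

/-- **The closure of the commutator subgroup is the intersection of the `Gal(E/L)`, `L/F` finite
abelian** — for `E/F` normal with `Aut_F(E)` compact (e.g. `E = F̄`,
`Literature.NumberTheory.GaloisRepresentations.compactSpace_algebraicClosure_algEquiv`): `Aut_F(E) ⧸ closure [·,·]` is the Galois group of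
the maximal abelian subextension.  `≤` is `topologicalClosure_commutator_le_fixingSubgroup`;
conversely, if `σ` fixes every finite abelian `L` but `σ ∉ C = closure [·,·]`, an open normal
subgroup `N` with `σ N ∩ C = ∅` (`ProfiniteGrp.exist_openNormalSubgroup_sub_open_nhds_of_one`)
gives the open normal subgroup `C N ⊇ [·,·]`, which is `Gal(E/L)` for a finite abelian `L`
(`exists_isAbelianGalois_fixingSubgroup_eq`), so `σ ∈ C N` — a contradiction.
Ref: Neukirch, *Algebraic Number Theory* (1999), Ch. IV §1; Serre, *Local Fields* (1979), Ch. XI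
§3 (`G^ab` of a profinite group). [folklore] -/
theorem mem_topologicalClosure_commutator_iff [Normal F E] [CompactSpace (E ≃ₐ[F] E)]
    (σ : E ≃ₐ[F] E) :
    σ ∈ (commutator (E ≃ₐ[F] E)).topologicalClosure ↔
      ∀ (L : IntermediateField F E) [FiniteDimensional F L] [IsAbelianGalois F L],
        σ ∈ L.fixingSubgroup := by
  constructor
  · intro hσ L _ _
    exact topologicalClosure_commutator_le_fixingSubgroup L hσ
  · intro hσ
    by_contra hC
    set C := (commutator (E ≃ₐ[F] E)).topologicalClosure with hCdef
    -- an open normal `N` with `σ N ∩ C = ∅`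
    have hO : IsOpen ((fun τ => σ * τ) ⁻¹' (C : Set (E ≃ₐ[F] E))ᶜ) :=
      (Subgroup.isClosed_topologicalClosure _).isOpen_compl.preimage
        (continuous_const.mul continuous_id)
    obtain ⟨N, hN⟩ :=
      ProfiniteGrp.exist_openNormalSubgroup_sub_open_nhds_of_one hO (by simpa using hC)
    -- the open normal subgroup `U = C N ⊇ [·,·]`
    let U : Subgroup (E ≃ₐ[F] E) := C ⊔ N.toSubgroup
    haveI : N.toSubgroup.Normal := N.isNormal'
    haveI : U.Normal := Subgroup.sup_normal _ _
    have hUopen : IsOpen (U : Set (E ≃ₐ[F] E)) :=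
      Subgroup.isOpen_mono le_sup_right N.isOpen
    have hcomm : ∀ a b : E ≃ₐ[F] E, a * b * a⁻¹ * b⁻¹ ∈ U := fun a b =>
      Subgroup.mem_sup_left (Subgroup.le_topologicalClosure _
        (Subgroup.commutator_mem_commutator (Subgroup.mem_top a) (Subgroup.mem_top b)))
    obtain ⟨L, hLfin, hLab, hLfix⟩ := exists_isAbelianGalois_fixingSubgroup_eq U hUopen hcomm
    haveI := hLfin
    haveI := hLab
    -- `σ ∈ Gal(E/L) = U = C N`
    have hσU : σ ∈ (U : Set (E ≃ₐ[F] E)) := by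
      have h := hσ L
      rw [hLfix] at h
      exact h
    rw [Subgroup.mul_normal] at hσU
    obtain ⟨c, hc, n, hn, hcn⟩ := hσU
    -- `σ n⁻¹ = c ∈ C` with `n⁻¹ ∈ N`: contradiction
    have h1 : σ * n⁻¹ ∈ C := by
      rw [← hcn, mul_inv_cancel_right]
      exact hc
    exact hN (N.toSubgroup.inv_mem hn) h1

end Normal

section AbsoluteGaloisGroup

open Field

variable (F : Type*) [Field F]

/-- **The case `E = F̄`**: an open normal subgroup of the absolute Galois group
`absoluteGaloisGroup F = Aut_F(F̄)` containing all commutators is `Gal(F̄/L)` for a finite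
abelian extension `L/F` inside `F̄` — in every characteristic.
Ref: Neukirch, *Algebraic Number Theory* (1999), Ch. IV §1, (1.2). [folklore] -/
theorem absoluteGaloisGroup.exists_isAbelianGalois_fixingSubgroup_eq
    (U : Subgroup (absoluteGaloisGroup F)) [hU : U.Normal]
    (hUopen : IsOpen (U : Set (absoluteGaloisGroup F)))
    (hcomm : ∀ a b : absoluteGaloisGroup F, a * b * a⁻¹ * b⁻¹ ∈ U) :
    ∃ L : IntermediateField F (AlgebraicClosure F), FiniteDimensional F L ∧ IsAbelianGalois F L ∧
      L.fixingSubgroup = (U : Subgroup (AlgebraicClosure F ≃ₐ[F] AlgebraicClosure F)) := by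
  exact @Literature.NumberTheory.GaloisRepresentations.exists_isAbelianGalois_fixingSubgroup_eq F (AlgebraicClosure F) _ _ _ _ U hU hUopen
    hcomm

/-- **The case `E = F̄`**: `σ ∈ Γ_F` lies in `closure [Γ_F, Γ_F]` iff it fixes every finite
abelian extension of `F` inside `F̄` (so `Γ_F^ab = Field.absoluteGaloisGroupAbelianization F` is
the Galois group of the maximal abelian extension), in every characteristic.
Ref: Neukirch, *Algebraic Number Theory* (1999), Ch. IV §1. [folklore] -/
theorem absoluteGaloisGroup.mem_topologicalClosure_commutator_iff (σ : absoluteGaloisGroup F) :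
    σ ∈ (commutator (absoluteGaloisGroup F)).topologicalClosure ↔
      ∀ (L : IntermediateField F (AlgebraicClosure F)) [FiniteDimensional F L]
        [IsAbelianGalois F L], absoluteGaloisGroup.toAlgEquiv F σ ∈ L.fixingSubgroup := by
  haveI : CompactSpace (AlgebraicClosure F ≃ₐ[F] AlgebraicClosure F) :=
    compactSpace_algebraicClosure_algEquiv F
  exact Literature.NumberTheory.GaloisRepresentations.mem_topologicalClosure_commutator_iff (F := F) (E := AlgebraicClosure F) σ

end AbsoluteGaloisGroup

end Literature.NumberTheory.GaloisRepresentations
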